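import Literature.Topology.FourManifolds.Bordism
import Literature.Topology.FourManifolds.HCobordantOfDiffeomorph
import HarnessLib

/-!
# Disjoint union of singular manifolds is commutative, associative and unital up to bordism
(proofs for `Bordism.lean`)

Topic `Literature/Topology/FourManifolds`.  Discharges of the named facts
`Literature.Topology.FourManifolds.ClosedSingularManifold.isBordant_sum_comm` (primarily),
`…isBordant_sum_assoc` and `…isBordant_sum_empty` stated in
`Literature/Topology/FourManifolds/Bordism.lean`:

* `ClosedSingularManifold.isBordant_sum_comm_holds : isBordant_sum_comm` — `(M ⊔ N, f ⊔ g)` is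
  bordant to `(N ⊔ M, g ⊔ f)`;
* `ClosedSingularManifold.isBordant_sum_assoc_holds : isBordant_sum_assoc` —
  `((M ⊔ N) ⊔ P, (f ⊔ g) ⊔ h)` is bordant to `(M ⊔ (N ⊔ P), f ⊔ (g ⊔ h))`;
* `ClosedSingularManifold.isBordant_sum_empty_holds : isBordant_sum_empty` — `(M ⊔ ∅, f ⊔ ∅)` is
  bordant to `(M, f)`.

These are the commutativity, associativity and unit laws of the abelian group `𝔑ₙ(X) = MO_n(X)`
of bordism classes of closed singular `n`-manifolds in `X` under disjoint union: Conner–Floyd,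
*Differentiable periodic maps* (1964), Ch. I, §4 ("an abelian group structure is imposed on
`MSO_n(X, A)` by disjoint union") and §8 (the unoriented groups `MO_n(X, A)`); Milnor–Stasheff,
*Characteristic classes* (1974), §17, p. 199 ff. (the cobordism group under `+ = ⊔`, manifolds
over a point); Atiyah, *Bordism and cobordism* (1961), §2.  The printed argument is that
`M ⊔ N ≅ N ⊔ M`, `(M ⊔ N) ⊔ P ≅ M ⊔ (N ⊔ P)`, `M ⊔ ∅ ≅ M` by diffeomorphisms commuting with the
maps to `X`, and diffeomorphic singular manifolds are bordant by the cylinder (Conner–Floyd,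
Ch. I, (2.1): "form the product manifold `I × Mⁿ` …"; Kervaire–Milnor, *Groups of homotopy
spheres I* (1963), §1: h-cobordism "is implied by diffeomorphism").

## Proof

All three are instances of one lemma, `ClosedSingularManifold.IsBordant.of_diffeomorph`: *if
`Φ : N ≅ M` is a diffeomorphism with `f ∘ Φ = g`, then `(M, f)` and `(N, g)` are bordant.*  Take
the cylinder `M × [0, 1]` as a tree `Cobordism n M M` modelled on `𝓡∂ (n + 1)`
(`Literature.Topology.FourManifolds.cylinderCobordism`, `CylinderCobordism.lean`; ends
`x ↦ (x, 0)`, `x ↦ (x, 1)`, projection `Cylinder.proj`), re-parametrise its outgoing end by `Φ`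
(`Literature.Topology.FourManifolds.Cobordism.compDiffeomorphRight`, `HCobordantOfDiffeomorph.lean`:
a smooth embedding precomposed with a diffeomorphism is a smooth embedding, same total space),
and map the cylinder to `X` by `F = f ∘ pr₁`, which restricts to `f` on the bottom and to
`f ∘ Φ = g` on the top, both *definitionally*.  The carrier of a closed singular manifold is
Hausdorff by definition and second countable as a compact charted space over `ℝⁿ` (Mathlib
`ChartedSpace.secondCountable_of_sigmaCompact`).  The three diffeomorphisms are Mathlib's
`Diffeomorph.sumComm` (`Sum.swap`), `Diffeomorph.sumAssoc` and `Diffeomorph.sumEmpty`; the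
compatibility with the structure maps `Sum.elim f g` holds by `rfl` on constructors.
(Reflexivity, `Φ = id`, is `BordismReflProofs.lean`; `2 [M, f] = 0` is in `BordismProofs.lean`.)

## References

* P. E. Conner, E. E. Floyd, *Differentiable periodic maps*, Ergebnisse der Math. 33, Springer
  (1964), Ch. I, §2 (2.1), §4, §8.
* J. Milnor, J. Stasheff, *Characteristic classes*, Ann. of Math. Studies 76 (1974), §17.
  [MilnorStasheff1974]
* M. Kervaire, J. Milnor, *Groups of homotopy spheres I*, Ann. of Math. 77 (1963), §1.
  [KervaireMilnorAnnals1963]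
* J. Milnor, *Lectures on the h-cobordism theorem* (1965), §1. [MilnorHCobordism1965]
-/

open scoped Manifold ContDiff Topology
open Set Function

noncomputable section

namespace Literature.Topology.FourManifolds

universe u

namespace ClosedSingularManifold

variable {X : Type*} [TopologicalSpace X] {n : ℕ}

/-- **Diffeomorphic singular manifolds are bordant.**  If `s = (M, f)` and `t = (N, g)` are closed
singular `n`-manifolds on `X` and `Φ : N ≅ M` is a diffeomorphism with `f ∘ Φ = g`, then `s` and
`t` are bordant: the cylinder `M × [0, 1]` (`Literature.Topology.FourManifolds.cylinderCobordism`)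
with outgoing end re-parametrised as `y ↦ (Φ y, 1)`
(`Literature.Topology.FourManifolds.Cobordism.compDiffeomorphRight`), together with the map
`F = f ∘ pr₁`, is a bordism from `s` to `t`.  Conner–Floyd, *Differentiable periodic maps* (1964),
Ch. I, (2.1) (the cylinder `I × M`) and §4; Kervaire–Milnor (1963), §1 ("implied by
diffeomorphism"); Milnor–Stasheff (1974), §17. [cite: MilnorStasheff1974, §17] -/
theorem IsBordant.of_diffeomorph (s t : ClosedSingularManifold.{u} X n)
    (Φ : t.M ≃ₘ⟮𝓡 n, 𝓡 n⟯ s.M) (h : ∀ y, s.f (Φ y) = t.f y) : IsBordant s t :=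
  haveI : SecondCountableTopology s.M :=
    ChartedSpace.secondCountable_of_sigmaCompact (EuclideanSpace ℝ (Fin n)) s.M
  ⟨(cylinderCobordism n s.M).compDiffeomorphRight Φ,
    (⟨s.f, s.hf⟩ : C(s.M, X)).comp Cylinder.proj, fun _ => rfl, fun y => h y⟩

/-- **Disjoint union is commutative up to bordism** (discharge of the named fact
`Literature.Topology.FourManifolds.ClosedSingularManifold.isBordant_sum_comm`): `(M ⊔ N, f ⊔ g)` is
bordant to `(N ⊔ M, g ⊔ f)`, by the cylinder on `M ⊔ N` whose outgoing end is identified with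
`N ⊔ M` via `Sum.swap` (Mathlib `Diffeomorph.sumComm`; `IsBordant.of_diffeomorph`).  This is the
commutativity of the group `𝔑ₙ(X) = MO_n(X)` of bordism classes under disjoint union:
Conner–Floyd (1964), Ch. I, §4 and §8; Milnor–Stasheff (1974), §17, p. 199 ff.
[cite: MilnorStasheff1974, §17] -/
theorem isBordant_sum_comm_holds : isBordant_sum_comm.{u} (X := X) (n := n) := fun s t =>
  IsBordant.of_diffeomorph (s.sum t) (t.sum s) (Diffeomorph.sumComm (𝓡 n) t.M ∞ s.M)
    fun y => by cases y <;> rfl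

/-- **Disjoint union is associative up to bordism** (discharge of the named fact
`Literature.Topology.FourManifolds.ClosedSingularManifold.isBordant_sum_assoc`): the cylinder on
`(M ⊔ N) ⊔ P` with outgoing end identified with `M ⊔ (N ⊔ P)` via the inverse of Mathlib's
`Diffeomorph.sumAssoc` (`IsBordant.of_diffeomorph`).  Associativity of `𝔑ₙ(X)` under disjoint
union: Conner–Floyd (1964), Ch. I, §4 and §8; Milnor–Stasheff (1974), §17.
[cite: MilnorStasheff1974, §17] -/
theorem isBordant_sum_assoc_holds : isBordant_sum_assoc.{u} (X := X) (n := n) := fun s t r =>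
  IsBordant.of_diffeomorph ((s.sum t).sum r) (s.sum (t.sum r))
    (Diffeomorph.sumAssoc (𝓡 n) s.M ∞ t.M r.M).symm fun y => by
      rcases y with y | y | y <;> rfl

/-- **The empty singular manifold is a right unit for disjoint union up to bordism** (discharge of
the named fact `Literature.Topology.FourManifolds.ClosedSingularManifold.isBordant_sum_empty`): the
cylinder on `M ⊔ ∅` with outgoing end identified with `M` via the inverse of Mathlib's
`Diffeomorph.sumEmpty` (`IsBordant.of_diffeomorph`).  The class of `∅` is the zero of `𝔑ₙ(X)`:
Conner–Floyd (1964), Ch. I, §4 and §8; Milnor–Stasheff (1974), §17.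
[cite: MilnorStasheff1974, §17] -/
theorem isBordant_sum_empty_holds : isBordant_sum_empty.{u} (X := X) (n := n) := fun s =>
  IsBordant.of_diffeomorph (s.sum (empty X n)) s
    (Diffeomorph.sumEmpty (𝓡 n) s.M (M' := (empty X n).M) ∞).symm fun _ => rfl

end ClosedSingularManifold

end Literature.Topology.FourManifolds
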